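import Mathlib
import HarnessLib
import HarnessLib.Audit.Tags

/-!
# HodgeLocusCensusSliceTransversal — a transversal slice of length `≠ 1` separates the germ from
its smooth branch ('the fat point says `V_λ ≠ NL(pair)` at `X_F` as schemes')

HONEST FRAMING (verbatim, pub-hlocus cell): certified instances and evidence bearing on the general
Hodge conjecture; no claim.

DICTIONARY (cell files `CENSUS-SUMMARY.md` §2, verdict column 'candidate NONREDUCED' /
'NONREDUCED along NL(pair)'; companion of `HodgeLocusCensusSliceDimension.lean`).
`R = 𝒪_{V_λ, X_F}`; `A = 𝒪_{NL(pair), X_F}`; `NL(pair) ⊆ V_λ` as closed sub-germs = a SURJECTION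
`φ : R →+* A`, and '`V_λ = NL(pair)` as germs of schemes at `X_F`' = '`φ` is bijective' (its kernel,
the ideal of `NL(pair)` in `R`, is `⊥`).  The slice `X_F + Λ` is cut out by linear forms with images
`I = (s) ⊆ R`; `Λ` TRANSVERSAL to `NL(pair)` (a linear complement of `T_{X_F} NL(pair)`) = the slice of
the smooth germ `NL(pair)` is the reduced point: `I·A = 𝔪_A`.  The census measures the LENGTH of the
slice germ `R ⧸ I` (two kernels; NOT formalised).

What the kernel checks (no definitions; Mathlib only):
* `length_quotient_eq_one_iff` — `length_R (R ⧸ I) = 1 ↔ I` is maximal: 'slice of length 1' =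
  'slice is the reduced point'.
* `isMaximal_of_map_eq_maximalIdeal_of_bijective` — if `φ : R →+* A` is bijective and `I·A = 𝔪_A`
  then `I` is maximal: were `V_λ = NL(pair)` at `X_F`, a transversal slice would have length `1`.
* `ker_ne_bot_of_length_ne_one` — CENSUS READING: `φ` surjective, `I·A = 𝔪_A`, `length (R ⧸ I) ≠ 1`
  (e.g. a FAT POINT of length `4, 7, 10, …`, or a curve germ) ⇒ `ker φ ≠ ⊥`: `V_λ` is STRICTLY LARGER
  than `NL(pair)` at `X_F` as a scheme — non-reduced along `NL(pair)` and/or with further components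
  through `X_F` (which of the two is NOT decided by the length alone; the census decides it with the
  dimension bound of `HodgeLocusCensusSliceDimension` and the explained-type components).
NOT formalised: everything Hodge-theoretic, and the finite computations producing the lengths.
-/

namespace Summit.HodgeConjecture.HodgeConjecture.HodgeLocus.Census

open IsLocalRing

variable {R A : Type*} [CommRing R] [CommRing A]

/-- 'slice of length one' = 'slice is the reduced point': for an ideal `I` of a commutative ring,
`length_R (R ⧸ I) = 1 ↔ I` is a maximal ideal. -/
theorem length_quotient_eq_one_iff (I : Ideal R) :
    Module.length R (R ⧸ I) = 1 ↔ I.IsMaximal := by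
  rw [Module.length_eq_one_iff, Ideal.isMaximal_def]
  exact isSimpleModule_iff_isCoatom

/-- If `φ : R →+* A` is bijective (the two germs coincide as schemes) and the slice ideal `I ⊆ R`
generates the maximal ideal of the local ring `A` (the slice is transversal to the smooth branch), then
`I` is maximal in `R` (the slice of `R` is the reduced point too). -/
theorem isMaximal_of_map_eq_maximalIdeal_of_bijective [IsLocalRing A] (φ : R →+* A)
    (hφ : Function.Bijective φ) (I : Ideal R) (htrans : I.map φ = maximalIdeal A) :
    I.IsMaximal := by
  have h := Ideal.comap_map_of_bijective φ hφ (I := I)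
  rw [htrans] at h
  rw [← h]
  exact Ideal.comap_isMaximal_of_surjective φ hφ.2

/-- **Census reading of a slice of length `≠ 1`.**  `φ : R →+* A` surjective (`NL(pair) ⊆ V_λ` at
`X_F`), `A` local, `I·A = 𝔪_A` (transversal slice), and `length_R (R ⧸ I) ≠ 1` (a fat point of
length `≥ 2`, or a slice of infinite length).  Then `ker φ ≠ ⊥`: `V_λ ≠ NL(pair)` as germs of schemes
at `X_F`. -/
theorem ker_ne_bot_of_length_ne_one [IsLocalRing A] (φ : R →+* A) (hφ : Function.Surjective φ)
    (I : Ideal R) (htrans : I.map φ = maximalIdeal A) (hlen : Module.length R (R ⧸ I) ≠ 1) :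
    RingHom.ker φ ≠ ⊥ := by
  intro hker
  have hinj : Function.Injective φ := (RingHom.injective_iff_ker_eq_bot φ).mpr hker
  have hmax := isMaximal_of_map_eq_maximalIdeal_of_bijective φ ⟨hinj, hφ⟩ I htrans
  exact hlen ((length_quotient_eq_one_iff I).mpr hmax)

/-- Numerical instance matching the (8,3,1) census lengths: `4 ≠ 1`, `7 ≠ 1`, `10 ≠ 1` in `ℕ∞`
(so every FAT-POINT row of row O8 satisfies the hypothesis of `ker_ne_bot_of_length_ne_one`). -/
theorem census831_lengths_ne_one : (4 : ℕ∞) ≠ 1 ∧ (7 : ℕ∞) ≠ 1 ∧ (10 : ℕ∞) ≠ 1 := by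
  refine ⟨?_, ?_, ?_⟩ <;> decide

end Summit.HodgeConjecture.HodgeConjecture.HodgeLocus.Census
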